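import Literature.Geometry.Kaehler.ComplexTorusWeilNeronSeveri
import Mathlib.LinearAlgebra.Projection
import Mathlib.LinearAlgebra.FiniteDimensional.Lemmas
import Mathlib.LinearAlgebra.Matrix.Rank
import HarnessLib

/-!
# The explicit Weil torus in lattice coordinates: `Φ = (P ζ, Q ζ̄)`, `ℂ⁴ = N_Q ⊕ N_P`, `I_t = i(π_Q - π_P)`

Structure file for the proof that the explicit complex torus of Weil type
`X = ℂ⁴/Φ(ℤ⁸)`, `Φ = Weil.periodEquiv` (`Literature/Geometry/Kaehler/ComplexTorusWeilPeriod.lean`,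
transcendental period `t`), is SIMPLE (C. Voisin, IMRN 2002 no. 20, §3 Prop. 3 (ii): "`X` is simple"
for the general torus of Weil type) — the second ingredient, with `NS(X) = 0`
(`ComplexTorusWeilNeronSeveri.lean`), of Voisin's derivation of assumption (b) of her §2 ("`X` has
no proper positive-dimensional analytic subset") from Ueno's structure theory. The simplicity proof
is in `ComplexTorusWeilSimple.lean`; here is the linear algebra of the torus in Voisin's coordinates:

* `Weil.zetaEquiv : ℝ⁸ ≃ₗ[ℝ] ℂ⁴`, the complex lattice coordinates `ζ_m = x_{2m} + i x_{2m+1}`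
  (`Γ_ℚ = K⁴`, `K = ℚ(i)`), in which the `ℤ[I]`-structure `A = rotMatrix` (`Weil.rotLin`) is
  multiplication by `i` (`zetaVec_rotLin`);
* `Weil.Pmap = (1 | T₁)`, `Weil.Qmap = (T₂ | 1)` and **`Φ(x) = (P ζ(x), Q ζ̄(x))`**
  (`periodEquiv_eq_zeta`); the complex planes `N_P = ker P` (Voisin's `W_i`, basis `g₁, g₂`) and
  `N_Q = ker Q` (`\overline{W_{-i}}`, basis `h₁, h₂`) with **`ℂ⁴ = N_Q ⊕ N_P`** (`isCompl_NQ_NP`,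
  i.e. `det(1 - T₂T₁) ≠ 0`) and the projections `π_Q`, `π_P`;
* the complex structure `Weil.cs = I_t = Φ⁻¹ ∘ i ∘ Φ` of `X` on `Γ_ℝ = ℝ⁸` and the KEY FORMULA
  **`ζ(I_t x) = i π_Q ζ(x) - i π_P ζ(x)`** (`zetaVec_cs`): `I_t = i(π_Q - π_P)` is `K`-linear;
  `cs_rotLin` (`I_t` commutes with `A`: the lattice is of Weil type);
* vocabulary for the sequel: Gaussian-rational vectors `gaussVec a b`, rational vectors `ratVec q`,
  the complex subspace `Weil.cx U ⊆ ℂ⁴` of an `A`-stable real subspace `U ⊆ ℝ⁸`, the `ℂ`-linear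
  map `Weil.antiMap L` of a real map `L` anticommuting with `A` (`ζ(L x) = M''(ζ̄(x))`), the
  dot-product functionals `dotL`, `dotL₂`, `dotR`, the rational matrix `rotQ = A` on `ℚ⁸`, and the
  Hermitian pairing formula `ζ(x)·\overline{ζ(w)} = x·w + i x·(Aw)` (`zetaVec_dot_star`).

Everything is a definition with a body or a theorem; no named fact is introduced.

## References

* C. Voisin, *A counterexample to the Hodge conjecture extended to Kähler varieties*, IMRN 2002
  no. 20, 1057–1075 (arXiv:math/0112247), §3 p. 5 (the torus of Weil type, `W = W_i ⊕ W_{-i}`,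
  `W ∩ Γ_ℝ = {0}`) and Prop. 3 (ii) ("`X` is simple" for the general member).
  [Voisin2002KaehlerCounterexample]
* Ch. Birkenhake, H. Lange, *Complex Abelian Varieties* (1992), §1.1–1.2 (period matrices, complex
  subtori and rational complex subspaces). [LangeBirkenhake1992]
-/

noncomputable section

open scoped ComplexConjugate Matrix
open Polynomial Module

namespace Literature.Geometry.Kaehler

namespace Weil

/-! ### The complex lattice coordinates as a real-linear isomorphism `ℝ⁸ ≃ ℂ⁴` -/

/-- The vector of complex lattice coordinates `ζ(x) = (ζ₀, ζ₁, ζ₂, ζ₃)`, `ζ_m = x_{2m} + i x_{2m+1}`.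
[cite: Voisin2002KaehlerCounterexample, §3 p. 5] -/
def zetaVec (x : Fin 8 → ℝ) : Fin 4 → ℂ := fun m ↦ zeta m x

/-- The inverse coordinates: `(u₀.re, u₀.im, u₁.re, u₁.im, …)`. [folklore] -/
def unzeta (u : Fin 4 → ℂ) : Fin 8 → ℝ :=
  ![(u 0).re, (u 0).im, (u 1).re, (u 1).im, (u 2).re, (u 2).im, (u 3).re, (u 3).im]

/-- `ζ₀ = x₀ + i x₁`. [folklore] -/
@[simp] theorem zetaVec_apply_zero (x : Fin 8 → ℝ) : zetaVec x 0 = ⟨x 0, x 1⟩ := rfl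
/-- `ζ₁ = x₂ + i x₃`. [folklore] -/
@[simp] theorem zetaVec_apply_one (x : Fin 8 → ℝ) : zetaVec x 1 = ⟨x 2, x 3⟩ := rfl
/-- `ζ₂ = x₄ + i x₅`. [folklore] -/
@[simp] theorem zetaVec_apply_two (x : Fin 8 → ℝ) : zetaVec x 2 = ⟨x 4, x 5⟩ := rfl
/-- `ζ₃ = x₆ + i x₇`. [folklore] -/
@[simp] theorem zetaVec_apply_three (x : Fin 8 → ℝ) : zetaVec x 3 = ⟨x 6, x 7⟩ := rfl

/-- **`ζ : ℝ⁸ ≃ₗ[ℝ] ℂ⁴`**, the real-linear isomorphism of complex lattice coordinates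
(Voisin's `Γ_ℝ ≅ ℂ⁴`). [cite: Voisin2002KaehlerCounterexample, §3 p. 5] -/
def zetaEquiv : (Fin 8 → ℝ) ≃ₗ[ℝ] (Fin 4 → ℂ) where
  toFun := zetaVec
  invFun := unzeta
  map_add' x y := by funext m; fin_cases m <;> apply Complex.ext <;> simp [zetaVec]
  map_smul' r x := by funext m; fin_cases m <;> apply Complex.ext <;> simp [zetaVec]
  left_inv x := by funext j; fin_cases j <;> simp [unzeta, zetaVec]
  right_inv u := by funext m; fin_cases m <;> apply Complex.ext <;> simp [unzeta, zetaVec]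

/-- `zetaEquiv` is `zetaVec` (definitional). [folklore] -/
@[simp] theorem zetaEquiv_apply (x : Fin 8 → ℝ) : zetaEquiv x = zetaVec x := rfl

/-- The real matrix of the `ℤ[I]`-structure `I = rotMatrix`, as a linear map `A` of `ℝ⁸`. [folklore] -/
def rotLin : (Fin 8 → ℝ) →ₗ[ℝ] (Fin 8 → ℝ) :=
  Matrix.mulVecLin (rotMatrix.map (Int.cast : ℤ → ℝ))

/-- `rotLin` is multiplication by the real matrix of `rotMatrix` (definitional). [folklore] -/
theorem rotLin_apply (x : Fin 8 → ℝ) : rotLin x = (rotMatrix.map (Int.cast : ℤ → ℝ)).mulVec x := rfl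

/-- `ζ(A x) = i ζ(x)`: `A` is multiplication by `i` in the coordinates `ζ`.
[cite: Voisin2002KaehlerCounterexample, §3 p. 5] -/
theorem zetaVec_rotLin (x : Fin 8 → ℝ) : zetaVec (rotLin x) = Complex.I • zetaVec x := by
  funext m
  exact zeta_rotMatrix m x

/-- `A² = -1`. [folklore] -/
theorem rotLin_rotLin (x : Fin 8 → ℝ) : rotLin (rotLin x) = -x := by
  apply zetaEquiv.injective
  simp only [zetaEquiv_apply, zetaVec_rotLin, map_neg, smul_smul, Complex.I_mul_I, neg_one_smul]

/-! ### The period map in the coordinates `ζ`: `Φ(x) = (P ζ(x), Q ζ̄(x))` -/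

/-- `P = (1 | T₁) : ℂ⁴ → ℂ²`, `u ↦ (u₀ + t u₂ + t² u₃, u₁ + t³ u₂ + t⁵ u₃)`.
[cite: Voisin2002KaehlerCounterexample, §3 p. 5] -/
def Pmap : (Fin 4 → ℂ) →ₗ[ℂ] (Fin 2 → ℂ) where
  toFun u := ![u 0 + (tV : ℂ) * u 2 + (tV : ℂ) ^ 2 * u 3, u 1 + (tV : ℂ) ^ 3 * u 2 + (tV : ℂ) ^ 5 * u 3]
  map_add' u v := by funext j; fin_cases j <;> simp <;> ring
  map_smul' c u := by funext j; fin_cases j <;> simp <;> ring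

/-- `Q = (T₂ | 1) : ℂ⁴ → ℂ²`, `u ↦ (t¹⁰ u₀ + t²⁰ u₁ + u₂, t³⁰ u₀ + t⁵⁰ u₁ + u₃)`.
[cite: Voisin2002KaehlerCounterexample, §3 p. 5] -/
def Qmap : (Fin 4 → ℂ) →ₗ[ℂ] (Fin 2 → ℂ) where
  toFun u := ![(tV : ℂ) ^ 10 * u 0 + (tV : ℂ) ^ 20 * u 1 + u 2, (tV : ℂ) ^ 30 * u 0 + (tV : ℂ) ^ 50 * u 1 + u 3]
  map_add' u v := by funext j; fin_cases j <;> simp <;> ring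
  map_smul' c u := by funext j; fin_cases j <;> simp <;> ring

/-- The two components of `P u`. [folklore] -/
theorem Pmap_apply (u : Fin 4 → ℂ) : Pmap u =
    ![u 0 + (tV : ℂ) * u 2 + (tV : ℂ) ^ 2 * u 3, u 1 + (tV : ℂ) ^ 3 * u 2 + (tV : ℂ) ^ 5 * u 3] := rfl

/-- The two components of `Q u`. [folklore] -/
theorem Qmap_apply (u : Fin 4 → ℂ) : Qmap u =
    ![(tV : ℂ) ^ 10 * u 0 + (tV : ℂ) ^ 20 * u 1 + u 2, (tV : ℂ) ^ 30 * u 0 + (tV : ℂ) ^ 50 * u 1 + u 3] := rfl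

/-- `Q` has real coefficients: `Q ū = \overline{Q u}`. [folklore] -/
theorem Qmap_star (u : Fin 4 → ℂ) : Qmap (star u) = star (Qmap u) := by
  funext j
  fin_cases j <;> simp [Qmap_apply, Complex.conj_ofReal]

/-- `P` has real coefficients: `P ū = \overline{P u}`. [folklore] -/
theorem Pmap_star (u : Fin 4 → ℂ) : Pmap (star u) = star (Pmap u) := by
  funext j
  fin_cases j <;> simp [Pmap_apply, Complex.conj_ofReal]

/-- **The period isomorphism in the coordinates `ζ`**: `Φ(x) = (P ζ(x), Q \overline{ζ(x)})`.
[cite: Voisin2002KaehlerCounterexample, §3 p. 5] -/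
theorem periodEquiv_eq_zeta (x : Fin 8 → ℝ) :
    periodEquiv x = ![Pmap (zetaVec x) 0, Pmap (zetaVec x) 1,
      Qmap (star (zetaVec x)) 0, Qmap (star (zetaVec x)) 1] := by
  rw [periodEquiv_apply, periodMap_apply]
  funext j
  fin_cases j <;> simp [Pmap_apply, Qmap_apply, zetaVec]

/-- Two vectors of `ℝ⁸` with the same `P ζ` and `Q ζ̄` have the same periods. [folklore] -/
theorem periodEquiv_eq_iff {x y : Fin 8 → ℝ} :
    periodEquiv x = periodEquiv y ↔
      Pmap (zetaVec x) = Pmap (zetaVec y) ∧ Qmap (star (zetaVec x)) = Qmap (star (zetaVec y)) := by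
  constructor
  · intro h
    rw [periodEquiv_eq_zeta, periodEquiv_eq_zeta] at h
    refine ⟨?_, ?_⟩
    · funext j; fin_cases j
      · exact congrFun h 0
      · exact congrFun h 1
    · funext j; fin_cases j
      · exact congrFun h 2
      · exact congrFun h 3
  · rintro ⟨hP, hQ⟩
    rw [periodEquiv_eq_zeta, periodEquiv_eq_zeta, hP, hQ]

/-! ### The eigenspaces `N_P = ker P`, `N_Q = ker Q` and `ℂ⁴ = N_Q ⊕ N_P` -/

/-- `N_P = ker P` (Voisin's `W_i`, the graph of `-T₁`). [cite: Voisin2002KaehlerCounterexample, §3 p. 5] -/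
def NP : Submodule ℂ (Fin 4 → ℂ) := LinearMap.ker Pmap

/-- `N_Q = ker Q` (Voisin's `\overline{W_{-i}}`, the graph of `-T₂`). [cite: Voisin2002KaehlerCounterexample, §3 p. 5] -/
def NQ : Submodule ℂ (Fin 4 → ℂ) := LinearMap.ker Qmap

/-- Membership in `N_P = ker P`. [folklore] -/
theorem mem_NP {u : Fin 4 → ℂ} : u ∈ NP ↔ Pmap u = 0 := LinearMap.mem_ker
/-- Membership in `N_Q = ker Q`. [folklore] -/
theorem mem_NQ {u : Fin 4 → ℂ} : u ∈ NQ ↔ Qmap u = 0 := LinearMap.mem_ker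

/-- `g₁ = (-t, -t³, 1, 0) ∈ N_P`. [folklore] -/
def g₁ : Fin 4 → ℂ := ![-(tV : ℂ), -(tV : ℂ) ^ 3, 1, 0]
/-- `g₂ = (-t², -t⁵, 0, 1) ∈ N_P`. [folklore] -/
def g₂ : Fin 4 → ℂ := ![-(tV : ℂ) ^ 2, -(tV : ℂ) ^ 5, 0, 1]
/-- `h₁ = (1, 0, -t¹⁰, -t³⁰) ∈ N_Q`. [folklore] -/
def h₁ : Fin 4 → ℂ := ![1, 0, -(tV : ℂ) ^ 10, -(tV : ℂ) ^ 30]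
/-- `h₂ = (0, 1, -t²⁰, -t⁵⁰) ∈ N_Q`. [folklore] -/
def h₂ : Fin 4 → ℂ := ![0, 1, -(tV : ℂ) ^ 20, -(tV : ℂ) ^ 50]

/-- `g₁ ∈ N_P`. [folklore] -/
theorem g₁_mem : g₁ ∈ NP := by
  rw [mem_NP, Pmap_apply]; funext j; fin_cases j <;> simp [g₁]
/-- `g₂ ∈ N_P`. [folklore] -/
theorem g₂_mem : g₂ ∈ NP := by
  rw [mem_NP, Pmap_apply]; funext j; fin_cases j <;> simp [g₂]
/-- `h₁ ∈ N_Q`. [folklore] -/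
theorem h₁_mem : h₁ ∈ NQ := by
  rw [mem_NQ, Qmap_apply]; funext j; fin_cases j <;> simp [h₁]
/-- `h₂ ∈ N_Q`. [folklore] -/
theorem h₂_mem : h₂ ∈ NQ := by
  rw [mem_NQ, Qmap_apply]; funext j; fin_cases j <;> simp [h₂]

/-- Every `u ∈ N_P` is `u₂ g₁ + u₃ g₂`. [folklore] -/
theorem eq_of_mem_NP {u : Fin 4 → ℂ} (hu : u ∈ NP) : u = u 2 • g₁ + u 3 • g₂ := by
  rw [mem_NP, Pmap_apply] at hu
  have h0 := congrFun hu 0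
  have h1 := congrFun hu 1
  simp at h0 h1
  funext j; fin_cases j <;> simp [g₁, g₂]
  · linear_combination h0
  · linear_combination h1

/-- Every `u ∈ N_Q` is `u₀ h₁ + u₁ h₂`. [folklore] -/
theorem eq_of_mem_NQ {u : Fin 4 → ℂ} (hu : u ∈ NQ) : u = u 0 • h₁ + u 1 • h₂ := by
  rw [mem_NQ, Qmap_apply] at hu
  have h0 := congrFun hu 0
  have h1 := congrFun hu 1
  simp at h0 h1
  funext j; fin_cases j <;> simp [h₁, h₂]
  · linear_combination h0
  · linear_combination h1

/-- `N_Q ∩ N_P = 0`: this is `det(1 - T₂T₁) = p(t) ≠ 0` (cf. `periodMap_injective`). [cite: Voisin2002KaehlerCounterexample, §3 p. 5] -/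
theorem disjoint_NQ_NP : Disjoint NQ NP := by
  rw [Submodule.disjoint_def]
  intro u hQ hP
  rw [mem_NQ, Qmap_apply] at hQ
  rw [mem_NP, Pmap_apply] at hP
  have h0 := congrFun hP 0
  have h1 := congrFun hP 1
  have h2 := congrFun hQ 0
  have h3 := congrFun hQ 1
  simp at h0 h1 h2 h3
  have hp : aeval tV detPoly ≠ 0 := detPoly_aeval_ne_zero transcendental_tV
  rw [detPoly_aeval] at hp
  set t : ℂ := (tV : ℂ) with ht
  have hpu : ((1 - tV ^ 11 - tV ^ 23 - tV ^ 32 - tV ^ 56 - tV ^ 65 + tV ^ 66 : ℝ) : ℂ) * u 2 = 0 := by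
    push_cast
    linear_combination (1 - t ^ 32 - t ^ 55) * h2 + (t ^ 12 + t ^ 25) * h3
      - ((1 - t ^ 32 - t ^ 55) * t ^ 10 + (t ^ 12 + t ^ 25) * t ^ 30) * h0
      - ((1 - t ^ 32 - t ^ 55) * t ^ 20 + (t ^ 12 + t ^ 25) * t ^ 50) * h1
  have hpv : ((1 - tV ^ 11 - tV ^ 23 - tV ^ 32 - tV ^ 56 - tV ^ 65 + tV ^ 66 : ℝ) : ℂ) * u 3 = 0 := by
    push_cast
    linear_combination (t ^ 31 + t ^ 53) * h2 + (1 - t ^ 11 - t ^ 23) * h3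
      - ((t ^ 31 + t ^ 53) * t ^ 10 + (1 - t ^ 11 - t ^ 23) * t ^ 30) * h0
      - ((t ^ 31 + t ^ 53) * t ^ 20 + (1 - t ^ 11 - t ^ 23) * t ^ 50) * h1
  have hp' : ((1 - tV ^ 11 - tV ^ 23 - tV ^ 32 - tV ^ 56 - tV ^ 65 + tV ^ 66 : ℝ) : ℂ) ≠ 0 :=
    Complex.ofReal_ne_zero.2 hp
  have hu2 : u 2 = 0 := (mul_eq_zero.1 hpu).resolve_left hp'
  have hu3 : u 3 = 0 := (mul_eq_zero.1 hpv).resolve_left hp'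
  rw [hu2, hu3] at h0 h1
  simp only [mul_zero, add_zero] at h0 h1
  funext j; fin_cases j
  · exact h0
  · exact h1
  · exact hu2
  · exact hu3

/-- `g₁, g₂` are linearly independent. [folklore] -/
theorem linearIndependent_g : LinearIndependent ℂ ![g₁, g₂] := by
  rw [LinearIndependent.pair_iff]
  intro a b hab
  have h2 := congrFun hab 2
  have h3 := congrFun hab 3
  simp [g₁, g₂] at h2 h3
  exact ⟨h2, h3⟩

/-- `h₁, h₂` are linearly independent. [folklore] -/
theorem linearIndependent_h : LinearIndependent ℂ ![h₁, h₂] := by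
  rw [LinearIndependent.pair_iff]
  intro a b hab
  have h0 := congrFun hab 0
  have h1 := congrFun hab 1
  simp [h₁, h₂] at h0 h1
  exact ⟨h0, h1⟩

/-- `dim N_P ≥ 2` (it contains the independent `g₁, g₂`). [folklore] -/
theorem two_le_finrank_NP : 2 ≤ finrank ℂ NP := by
  have h : Submodule.span ℂ (Set.range ![g₁, g₂]) ≤ NP := by
    rw [Submodule.span_le]
    rintro _ ⟨j, rfl⟩
    fin_cases j
    · exact g₁_mem
    · exact g₂_mem
  have := Submodule.finrank_mono h
  rwa [finrank_span_eq_card linearIndependent_g, Fintype.card_fin] at this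

/-- `dim N_Q ≥ 2` (it contains the independent `h₁, h₂`). [folklore] -/
theorem two_le_finrank_NQ : 2 ≤ finrank ℂ NQ := by
  have h : Submodule.span ℂ (Set.range ![h₁, h₂]) ≤ NQ := by
    rw [Submodule.span_le]
    rintro _ ⟨j, rfl⟩
    fin_cases j
    · exact h₁_mem
    · exact h₂_mem
  have := Submodule.finrank_mono h
  rwa [finrank_span_eq_card linearIndependent_h, Fintype.card_fin] at this

/-- **`ℂ⁴ = N_Q ⊕ N_P`.** [cite: Voisin2002KaehlerCounterexample, §3 p. 5] -/
theorem isCompl_NQ_NP : IsCompl NQ NP := by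
  refine IsCompl.of_eq disjoint_NQ_NP.eq_bot ?_
  apply Submodule.eq_top_of_finrank_eq
  have h := Submodule.finrank_sup_add_finrank_inf_eq NQ NP
  rw [disjoint_NQ_NP.eq_bot, finrank_bot, add_zero] at h
  have h4 : finrank ℂ (Fin 4 → ℂ) = 4 := by simp
  rw [h4]
  have hle := Submodule.finrank_le (NQ ⊔ NP)
  rw [h4] at hle
  have := two_le_finrank_NQ
  have := two_le_finrank_NP
  omega

/-- The projection `π_Q` onto `N_Q` along `N_P`. [folklore] -/
def projQ : (Fin 4 → ℂ) →ₗ[ℂ] (Fin 4 → ℂ) := NQ.projection NP isCompl_NQ_NP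

/-- The projection `π_P` onto `N_P` along `N_Q`. [folklore] -/
def projP : (Fin 4 → ℂ) →ₗ[ℂ] (Fin 4 → ℂ) := NP.projection NQ isCompl_NQ_NP.symm

/-- `u = π_Q u + π_P u`. [folklore] -/
theorem projQ_add_projP (u : Fin 4 → ℂ) : projQ u + projP u = u :=
  Submodule.projection_add_projection_eq_self isCompl_NQ_NP u

/-- `π_Q u ∈ N_Q`. [folklore] -/
theorem projQ_mem (u : Fin 4 → ℂ) : projQ u ∈ NQ := Submodule.projection_apply_mem _ u
/-- `π_P u ∈ N_P`. [folklore] -/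
theorem projP_mem (u : Fin 4 → ℂ) : projP u ∈ NP := Submodule.projection_apply_mem _ u

/-- `π_Q` is the identity on `N_Q`. [folklore] -/
theorem projQ_eq_self {u : Fin 4 → ℂ} (hu : u ∈ NQ) : projQ u = u :=
  (Submodule.projection_eq_self_iff isCompl_NQ_NP u).2 hu

/-- `π_Q` kills `N_P`. [folklore] -/
theorem projQ_eq_zero {u : Fin 4 → ℂ} (hu : u ∈ NP) : projQ u = 0 :=
  (Submodule.projection_apply_eq_zero_iff isCompl_NQ_NP).2 hu

/-- `π_P` is the identity on `N_P`. [folklore] -/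
theorem projP_eq_self {u : Fin 4 → ℂ} (hu : u ∈ NP) : projP u = u :=
  (Submodule.projection_eq_self_iff isCompl_NQ_NP.symm u).2 hu

/-- `π_P` kills `N_Q`. [folklore] -/
theorem projP_eq_zero {u : Fin 4 → ℂ} (hu : u ∈ NQ) : projP u = 0 :=
  (Submodule.projection_apply_eq_zero_iff isCompl_NQ_NP.symm).2 hu

/-! ### The complex structure `I_t = Φ⁻¹ ∘ i ∘ Φ` in the coordinates `ζ` -/

/-- **The complex structure** of the explicit Weil torus on `ℝ⁸ = Γ_ℝ`: `I_t = Φ⁻¹ ∘ i ∘ Φ`.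
[cite: Voisin2002KaehlerCounterexample, §3 p. 5] -/
def cs : (Fin 8 → ℝ) →ₗ[ℝ] (Fin 8 → ℝ) :=
  (periodEquiv.symm.toLinearEquiv.toLinearMap.restrictScalars ℝ) ∘ₗ
    ((Complex.I • LinearMap.id : (Fin 4 → ℂ) →ₗ[ℂ] (Fin 4 → ℂ)).restrictScalars ℝ) ∘ₗ
    periodEquiv.toLinearEquiv.toLinearMap

/-- `I_t x = Φ⁻¹ (i Φ x)` (definitional). [folklore] -/
theorem cs_apply (x : Fin 8 → ℝ) : cs x = periodEquiv.symm (Complex.I • periodEquiv x) := rfl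

/-- `Φ (I_t x) = i Φ x`. [folklore] -/
theorem periodEquiv_cs (x : Fin 8 → ℝ) : periodEquiv (cs x) = Complex.I • periodEquiv x := by
  rw [cs_apply, ContinuousLinearEquiv.apply_symm_apply]

/-- **`I_t` in the coordinates `ζ`**: `ζ(I_t x) = i u_Q - i u_P` for `u = ζ(x) = u_Q + u_P`,
`u_Q ∈ N_Q`, `u_P ∈ N_P` — i.e. `I_t = i (π_Q - π_P)` acts by `+i` on `N_Q` and `-i` on `N_P`.
[cite: Voisin2002KaehlerCounterexample, §3 p. 5] -/
theorem zetaVec_cs (x : Fin 8 → ℝ) :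
    zetaVec (cs x) = Complex.I • projQ (zetaVec x) - Complex.I • projP (zetaVec x) := by
  set u := zetaVec x with hu
  obtain ⟨x', hx'⟩ := zetaEquiv.surjective (Complex.I • projQ u - Complex.I • projP u)
  rw [zetaEquiv_apply] at hx'
  have hPP : Pmap (projP u) = 0 := mem_NP.1 (projP_mem u)
  have hQQ : Qmap (star (projQ u)) = 0 := by
    rw [Qmap_star, mem_NQ.1 (projQ_mem u), star_zero]
  have hx'eq : periodEquiv x' = Complex.I • periodEquiv x := by
    rw [periodEquiv_eq_zeta, periodEquiv_eq_zeta, hx']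
    change _ = Complex.I • ![Pmap u 0, Pmap u 1, Qmap (star u) 0, Qmap (star u) 1]
    conv_rhs => rw [← projQ_add_projP u]
    simp only [map_sub, map_smul, map_add, star_sub, star_add, star_smul, Complex.star_def,
      Complex.conj_I, hPP, hQQ, smul_zero, sub_zero, add_zero, zero_add, neg_smul, sub_neg_eq_add]
    funext j
    fin_cases j <;> simp [hQQ]
  have hcs : x' = cs x := periodEquiv.injective (by rw [hx'eq, periodEquiv_cs])
  rw [← hcs, hx']

/-! ### Gaussian-rational and rational vectors -/

/-- A vector of `ℂ⁴` with Gaussian-rational coordinates `u_m = a_m + i b_m`. [folklore] -/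
def gaussVec (a b : Fin 4 → ℚ) : Fin 4 → ℂ := fun m ↦ ⟨(a m : ℝ), (b m : ℝ)⟩

/-- Real parts of a Gaussian-rational vector. [folklore] -/
@[simp] theorem gaussVec_re (a b : Fin 4 → ℚ) (m : Fin 4) : (gaussVec a b m).re = (a m : ℝ) := rfl
/-- Imaginary parts of a Gaussian-rational vector. [folklore] -/
@[simp] theorem gaussVec_im (a b : Fin 4 → ℚ) (m : Fin 4) : (gaussVec a b m).im = (b m : ℝ) := rfl

/-- A Gaussian-rational vector vanishes iff its rational data vanish. [folklore] -/
theorem gaussVec_eq_zero_iff (a b : Fin 4 → ℚ) : gaussVec a b = 0 ↔ a = 0 ∧ b = 0 := by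
  constructor
  · intro h
    refine ⟨funext fun m ↦ ?_, funext fun m ↦ ?_⟩
    · have := congrArg Complex.re (congrFun h m)
      simpa using this
    · have := congrArg Complex.im (congrFun h m)
      simpa using this
  · rintro ⟨rfl, rfl⟩
    funext m
    apply Complex.ext <;> simp

/-- The `q`-th column of a Gaussian-rational `4 × 4` matrix `(A_pq + i B_pq)`. [folklore] -/
def gaussCol (A B : Fin 4 → Fin 4 → ℚ) (q : Fin 4) : Fin 4 → ℂ :=
  gaussVec (fun p ↦ A p q) (fun p ↦ B p q)

/-- A rational vector `q ∈ ℚ⁸ = Γ_ℚ` viewed in `ℝ⁸ = Γ_ℝ`. [folklore] -/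
def ratVec (q : Fin 8 → ℚ) : Fin 8 → ℝ := fun j ↦ (q j : ℝ)

/-- Components of `ratVec q` (definitional). [folklore] -/
@[simp] theorem ratVec_apply (q : Fin 8 → ℚ) (j : Fin 8) : ratVec q j = (q j : ℝ) := rfl

/-- `ratVec` as a `ℚ`-linear map. [folklore] -/
def ratVecₗ : (Fin 8 → ℚ) →ₗ[ℚ] (Fin 8 → ℝ) where
  toFun := ratVec
  map_add' p q := by funext j; simp
  map_smul' c q := by funext j; simp [Rat.smul_def]

/-- `ratVecₗ` is `ratVec` (definitional). [folklore] -/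
@[simp] theorem ratVecₗ_apply (q : Fin 8 → ℚ) : ratVecₗ q = ratVec q := rfl

/-- `ratVec q = 0 ↔ q = 0`. [folklore] -/
theorem ratVec_eq_zero_iff {q : Fin 8 → ℚ} : ratVec q = 0 ↔ q = 0 := by
  constructor
  · intro h; funext j; have := congrFun h j; simpa using this
  · rintro rfl; funext j; simp


/-! ### Real scalars, `A` and `i` in the coordinates `ζ` -/

/-- `c • v = (Re c) v + (Im c) (i v)` for the real structure. [folklore] -/
theorem re_smul_add_im_smul (c : ℂ) (v : Fin 4 → ℂ) :
    (c.re : ℝ) • v + (c.im : ℝ) • (Complex.I • v) = c • v := by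
  funext m
  simp only [Pi.add_apply, Pi.smul_apply, Complex.real_smul, smul_eq_mul]
  have hc : (c.re : ℂ) + (c.im : ℂ) * Complex.I = c := Complex.re_add_im c
  linear_combination (v m) * hc

/-- `ζ⁻¹ (c • v) = (Re c) ζ⁻¹ v + (Im c) A ζ⁻¹ v`. [folklore] -/
theorem zetaEquiv_symm_smul (c : ℂ) (v : Fin 4 → ℂ) :
    zetaEquiv.symm (c • v) = (c.re : ℝ) • zetaEquiv.symm v + (c.im : ℝ) • rotLin (zetaEquiv.symm v) := by
  apply zetaEquiv.injective
  rw [LinearEquiv.apply_symm_apply, map_add, map_smul, map_smul, zetaEquiv_apply (rotLin _),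
    zetaVec_rotLin, ← zetaEquiv_apply, LinearEquiv.apply_symm_apply, re_smul_add_im_smul]

/-- `I = rotMatrix` commutes with the complex structure: `I_t (A x) = A (I_t x)` (the lattice is of
Weil type: `Φ ∘ A = J ∘ Φ` and `J` is `ℂ`-linear). [cite: Voisin2002KaehlerCounterexample, §3 p. 5] -/
theorem cs_rotLin (x : Fin 8 → ℝ) : cs (rotLin x) = rotLin (cs x) := by
  apply periodEquiv.injective
  rw [periodEquiv_cs, rotLin_apply, rotLin_apply, periodEquiv_rotMatrix, periodEquiv_rotMatrix,
    periodEquiv_cs, map_smul]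

/-- The Hermitian pairing in the coordinates `ζ` encodes the two real pairings `x·w` and `x·(A w)`:
`ζ(x)·\overline{ζ(w)} = x·w + i x·(A w)`. [folklore] -/
theorem zetaVec_dot_star (x w : Fin 8 → ℝ) :
    zetaVec x ⬝ᵥ star (zetaVec w) = ⟨x ⬝ᵥ w, x ⬝ᵥ rotLin w⟩ := by
  apply Complex.ext
  · simp [dotProduct, Fin.sum_univ_four, Fin.sum_univ_eight, zetaVec]
    ring
  · simp [dotProduct, Fin.sum_univ_four, Fin.sum_univ_eight, zetaVec, rotLin_apply, rotMatrix,
      Matrix.mulVec, Matrix.map_apply]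
    ring


/-! ### `A`-stable real subspaces of `Γ_ℝ` as complex subspaces of `ℂ⁴_ζ` -/

/-- An `A`-stable real subspace `U ⊆ ℝ⁸` viewed, through `ζ`, as a complex subspace of `ℂ⁴`
(`A` becomes multiplication by `i`). [cite: Voisin2002KaehlerCounterexample, §3 p. 5] -/
def cx (U : Submodule ℝ (Fin 8 → ℝ)) (hA : ∀ x ∈ U, rotLin x ∈ U) : Submodule ℂ (Fin 4 → ℂ) where
  carrier := zetaVec '' U
  add_mem' := by
    rintro _ _ ⟨x, hx, rfl⟩ ⟨y, hy, rfl⟩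
    exact ⟨x + y, U.add_mem hx hy, map_add zetaEquiv x y⟩
  zero_mem' := ⟨0, U.zero_mem, map_zero zetaEquiv⟩
  smul_mem' := by
    rintro c _ ⟨x, hx, rfl⟩
    refine ⟨(c.re : ℝ) • x + (c.im : ℝ) • rotLin x,
      U.add_mem (U.smul_mem _ hx) (U.smul_mem _ (hA x hx)), ?_⟩
    change zetaEquiv _ = c • zetaVec x
    rw [map_add, map_smul, map_smul, zetaEquiv_apply, zetaEquiv_apply, zetaVec_rotLin,
      re_smul_add_im_smul]

/-- Membership in `cx U`: the images `ζ(x)`, `x ∈ U`. [folklore] -/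
theorem mem_cx {U : Submodule ℝ (Fin 8 → ℝ)} {hA : ∀ x ∈ U, rotLin x ∈ U} {u : Fin 4 → ℂ} :
    u ∈ cx U hA ↔ ∃ x ∈ U, zetaVec x = u := Iff.rfl

/-- `ζ(x) ∈ cx U` for `x ∈ U`. [folklore] -/
theorem zetaVec_mem_cx {U : Submodule ℝ (Fin 8 → ℝ)} {hA : ∀ x ∈ U, rotLin x ∈ U} {x : Fin 8 → ℝ}
    (hx : x ∈ U) : zetaVec x ∈ cx U hA := ⟨x, hx, rfl⟩

/-- `ζ(x) ∈ cx U` only for `x ∈ U` (`ζ` is injective). [folklore] -/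
theorem mem_of_zetaVec_mem_cx {U : Submodule ℝ (Fin 8 → ℝ)} {hA : ∀ x ∈ U, rotLin x ∈ U}
    {x : Fin 8 → ℝ} (hx : zetaVec x ∈ cx U hA) : x ∈ U := by
  obtain ⟨y, hy, hyx⟩ := hx
  have : y = x := zetaEquiv.injective hyx
  exact this ▸ hy


/-! ### Real maps anticommuting with `A` as `ℂ`-linear maps of `ℂ⁴` -/

section AntiLinear

variable (L : (Fin 8 → ℝ) →ₗ[ℝ] (Fin 8 → ℝ))

/-- The `ℂ`-linear map `M''` of `ℂ⁴` attached to a real map `L` ANTICOMMUTING with `A`: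
`ζ(L x) = M''(\overline{ζ(x)})`. [folklore] -/
def antiMap (hanti : ∀ x, L (rotLin x) = -rotLin (L x)) : (Fin 4 → ℂ) →ₗ[ℂ] (Fin 4 → ℂ) where
  toFun u := zetaVec (L (zetaEquiv.symm (star u)))
  map_add' u v := by
    rw [star_add, map_add, map_add]
    exact map_add zetaEquiv _ _
  map_smul' c u := by
    rw [star_smul, zetaEquiv_symm_smul, map_add, map_smul, map_smul, hanti]
    change zetaEquiv _ = c • zetaVec _
    simp only [map_add, map_smul, zetaEquiv_apply, zetaVec_rotLin, Complex.star_def,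
      Complex.conj_re, Complex.conj_im, neg_smul, smul_neg, neg_neg]
    exact re_smul_add_im_smul c _

variable (hanti : ∀ x, L (rotLin x) = -rotLin (L x))

/-- `M'' u = ζ(L(ζ⁻¹ ū))` (definitional). [folklore] -/
theorem antiMap_apply (u : Fin 4 → ℂ) :
    antiMap L hanti u = zetaVec (L (zetaEquiv.symm (star u))) := rfl

/-- `ζ(L x) = M''(\overline{ζ(x)})`. [folklore] -/
theorem zetaVec_L (x : Fin 8 → ℝ) : zetaVec (L x) = antiMap L hanti (star (zetaVec x)) := by
  rw [antiMap_apply, star_star]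
  congr 2
  exact (zetaEquiv.symm_apply_apply x).symm


end AntiLinear

/-- `ζ⁻¹` of the (conjugated) standard basis vectors of `ℂ⁴`. [folklore] -/
theorem zetaEquiv_symm_star_single (q : Fin 4) :
    zetaEquiv.symm (star (Pi.single q (1 : ℂ))) = Pi.single (![0, 2, 4, 6] q : Fin 8) 1 := by
  apply zetaEquiv.injective
  rw [LinearEquiv.apply_symm_apply, zetaEquiv_apply]
  funext m
  fin_cases q <;> fin_cases m <;> apply Complex.ext <;> simp [zetaVec]


/-! ### Dot products, and `A` on `ℚ⁸` -/

/-- The complex-linear functional `v ↦ v · c` on `ℂ⁴`. [folklore] -/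
def dotL (c : Fin 4 → ℂ) : (Fin 4 → ℂ) →ₗ[ℂ] ℂ where
  toFun v := v ⬝ᵥ c
  map_add' v w := add_dotProduct v w c
  map_smul' a v := smul_dotProduct a v c

/-- `dotL c v = v · c` (definitional). [folklore] -/
@[simp] theorem dotL_apply (c v : Fin 4 → ℂ) : dotL c v = v ⬝ᵥ c := rfl

/-- The pair of functionals `v ↦ (v · c, v · c')`. [folklore] -/
def dotL₂ (c c' : Fin 4 → ℂ) : (Fin 4 → ℂ) →ₗ[ℂ] (Fin 2 → ℂ) where
  toFun v := ![v ⬝ᵥ c, v ⬝ᵥ c']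
  map_add' v w := by funext i; fin_cases i <;> simp [add_dotProduct]
  map_smul' a v := by funext i; fin_cases i <;> simp [smul_dotProduct]

/-- `dotL₂ c c' v = (v · c, v · c')` (definitional). [folklore] -/
@[simp] theorem dotL₂_apply (c c' v : Fin 4 → ℂ) : dotL₂ c c' v = ![v ⬝ᵥ c, v ⬝ᵥ c'] := rfl

/-- The real-linear functional `x ↦ x · w` on `ℝ⁸`. [folklore] -/
def dotR (w : Fin 8 → ℝ) : (Fin 8 → ℝ) →ₗ[ℝ] ℝ where
  toFun x := x ⬝ᵥ w
  map_add' x y := add_dotProduct x y w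
  map_smul' a x := smul_dotProduct a x w

/-- `dotR w x = x · w` (definitional). [folklore] -/
@[simp] theorem dotR_apply (w x : Fin 8 → ℝ) : dotR w x = x ⬝ᵥ w := rfl

/-- `A` is skew for the dot product: `x · (A w) = -(A x) · w`. [folklore] -/
theorem dotProduct_rotLin (x w : Fin 8 → ℝ) : x ⬝ᵥ rotLin w = -(rotLin x ⬝ᵥ w) := by
  simp [dotProduct, Fin.sum_univ_eight, rotLin_apply, rotMatrix, Matrix.mulVec, Matrix.map_apply]
  ring

/-- Dot products of rational vectors are rational. [folklore] -/
theorem ratVec_dotProduct (p q : Fin 8 → ℚ) : ratVec p ⬝ᵥ ratVec q = ((p ⬝ᵥ q : ℚ) : ℝ) := by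
  simp [dotProduct]

/-- The rational matrix `A = rotMatrix` acting on `ℚ⁸`. [folklore] -/
def rotQ (q : Fin 8 → ℚ) : Fin 8 → ℚ := rotMatrix.map (Int.cast : ℤ → ℚ) *ᵥ q

/-- `rotQ` is `A = rotLin` on rational vectors. [folklore] -/
theorem ratVec_rotQ (q : Fin 8 → ℚ) : ratVec (rotQ q) = rotLin (ratVec q) := by
  funext j
  fin_cases j <;>
    simp [rotQ, rotLin_apply, Matrix.mulVec, dotProduct, Fin.sum_univ_eight, rotMatrix, Matrix.map_apply]

/-- The standard basis vectors are rational. [folklore] -/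
theorem ratVec_single (j : Fin 8) : ratVec (Pi.single j 1) = Pi.single j 1 := by
  funext l; by_cases h : l = j
  · subst h; simp
  · simp [h]


end Weil

end Literature.Geometry.Kaehler

end
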